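import Mathlib
import HarnessLib
import Summits.ValiantsHypothesis.ValiantsHypothesis.Theorems.LacunarySymmetroidMatrixDescartesOsculationLawCuspCubicCountPrelim

/-!
# ValiantsHypothesis / LacunarySymmetroid — crux `MatrixDescartes` (stmt-ValiantsHypothesis-18050, V1),
# line «osculation-law»: the MONIC CUBIC cusp curve — the COUNT

File 3/4 of the `(r,s) = (3,0)` piece of the `m = 3` rung.  Abstract counting theorem for the osculation set of a
monic cubic curve `Φ(t,b) = b³ + σ₁(t)b² + σ₂(t)b + σ₃(t)`.  The set `osc` is taken ABSTRACTLY through the two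
properties the algebra file (`…OsculationLawCuspCubic`) provides — on `osc` the Hessian condition is the quadratic
`R₂(t)b² + R₁(t)b + R₀(t) = 0` (`hout`), and conversely every positive point of the curve satisfying it lies in `osc`
(`hin`) — together with real-rootedness of `Φ(t,·)` (`hreal`, a factorisation for every `t`) and ROOT PERSISTENCE
(`hpersist`: a positive root of `Φ(t₀,·)` propagates to positive roots of `Φ(t,·)` for `t` near `t₀`; for symmetric
pencils this is "a negative eigenvalue persists").

`cubic_curve_ncard_le` (**main**): if `osc` is finite then
`#osc ≤ |supp N| + |supp N′| + 3(|supp R₂| + |supp R₁| + |supp R₀| + |supp L₁| + |supp L₀|)` with the second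
Euclid step `L₁ = σ₂R₂² − R₀R₂ − σ₁R₁R₂ + R₁²`, `L₀ = σ₃R₂² − σ₁R₀R₂ + R₀R₁`, the resultant
`N = R₂L₀² − R₁L₀L₁ + R₀L₁²` and the linear-regime resultant `N′ = σ₃R₁³ − σ₂R₀R₁² + σ₁R₀²R₁ − R₀³`.
Strata of abscissae: `R₂(t) = 0`, `L₁(t) = 0`, `L₀(t) = 0` (resp. `R₁(t) = 0`, `R₀(t) = 0` when `R₂ ≡ 0`) carry at
most three ordinates each (`fibre_three_le`); generic abscissae carry one ordinate and inject into the positive roots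
of `N` (resp. `N′`) (`inj_le`); every identically vanishing stratum — `N ≡ 0`, `L₁ ≡ L₀ ≡ 0` (then `R(t,·)` divides
`R₂²Φ(t,·)` and is real-rooted, `disc_nonneg_of_factor`, so a root branch `(−R₁ ± √disc)/(2R₂)` is available),
`R ≡ 0` (persistence) — is an OPEN ARC of abscissae (`OsculationCusp.infinite_of_curve`), so finiteness empties it.
Positive roots are bounded by monomial counts through Descartes' rule with multiplicity.

Honest framing: a located rung piece of an UNREGISTERED V1 law line (ideator val-idea-2); `OsculationLaw` (all `m`),
`PeelInequality`, `MatrixDescartes`, Conjecture B and `VP ≠ VNP` are OPEN / NOT proved; nothing here is progress on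
them.  No definitions, no named facts; Mathlib + the line's `m = 2` files only.
-/

-- `Summit.ValiantsHypothesis.ValiantsHypothesis.…` is the tree's mandated single-conjunct layout (Sub = Summit).
set_option linter.dupNamespace false

noncomputable section

namespace Summit.ValiantsHypothesis.ValiantsHypothesis.Theorems.LacunarySymmetroidMatrixDescartes

open Polynomial Set
open scoped BigOperators

namespace OsculationCuspCubic

set_option maxHeartbeats 1600000 in
/-- **Cubic cusp curve — the count.**  See the module docstring. [folklore] -/
theorem cubic_curve_ncard_le (σ₁ σ₂ σ₃ R₂ R₁ R₀ : ℝ[X]) (osc : Set (Fin 2 → ℝ))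
    (hout : ∀ p ∈ osc, 0 < p 0 ∧ 0 < p 1 ∧
      p 1 ^ 3 + p 1 ^ 2 * σ₁.eval (p 0) + p 1 * σ₂.eval (p 0) + σ₃.eval (p 0) = 0 ∧
      R₂.eval (p 0) * p 1 ^ 2 + R₁.eval (p 0) * p 1 + R₀.eval (p 0) = 0)
    (hin : ∀ t b : ℝ, 0 < t → 0 < b → b ^ 3 + b ^ 2 * σ₁.eval t + b * σ₂.eval t + σ₃.eval t = 0 →
      R₂.eval t * b ^ 2 + R₁.eval t * b + R₀.eval t = 0 → (![t, b] : Fin 2 → ℝ) ∈ osc)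
    (hreal : ∀ t : ℝ, ∃ μ₁ μ₂ μ₃ : ℝ, ∀ b : ℝ,
      b ^ 3 + b ^ 2 * σ₁.eval t + b * σ₂.eval t + σ₃.eval t = (b - μ₁) * (b - μ₂) * (b - μ₃))
    (hpersist : ∀ t₀ b₀ : ℝ, 0 < b₀ → b₀ ^ 3 + b₀ ^ 2 * σ₁.eval t₀ + b₀ * σ₂.eval t₀ + σ₃.eval t₀ = 0 →
      ∃ U : Set ℝ, IsOpen U ∧ t₀ ∈ U ∧ ∃ γ : ℝ → ℝ, ∀ t ∈ U, 0 < γ t ∧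
        γ t ^ 3 + γ t ^ 2 * σ₁.eval t + γ t * σ₂.eval t + σ₃.eval t = 0)
    (hfin : osc.Finite) :
    osc.ncard ≤
      (R₂ * (σ₃ * R₂ ^ 2 - σ₁ * R₀ * R₂ + R₀ * R₁) ^ 2
          - R₁ * (σ₃ * R₂ ^ 2 - σ₁ * R₀ * R₂ + R₀ * R₁) * (σ₂ * R₂ ^ 2 - R₀ * R₂ - σ₁ * R₁ * R₂ + R₁ ^ 2)
          + R₀ * (σ₂ * R₂ ^ 2 - R₀ * R₂ - σ₁ * R₁ * R₂ + R₁ ^ 2) ^ 2).support.card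
      + (σ₃ * R₁ ^ 3 - σ₂ * R₀ * R₁ ^ 2 + σ₁ * R₀ ^ 2 * R₁ - R₀ ^ 3).support.card
      + 3 * (R₂.support.card + R₁.support.card + R₀.support.card
          + (σ₂ * R₂ ^ 2 - R₀ * R₂ - σ₁ * R₁ * R₂ + R₁ ^ 2).support.card
          + (σ₃ * R₂ ^ 2 - σ₁ * R₀ * R₂ + R₀ * R₁).support.card) := by
  classical
  set L₁ : ℝ[X] := σ₂ * R₂ ^ 2 - R₀ * R₂ - σ₁ * R₁ * R₂ + R₁ ^ 2 with hL₁def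
  set L₀ : ℝ[X] := σ₃ * R₂ ^ 2 - σ₁ * R₀ * R₂ + R₀ * R₁ with hL₀def
  set N : ℝ[X] := R₂ * L₀ ^ 2 - R₁ * L₀ * L₁ + R₀ * L₁ ^ 2 with hNdef
  set N' : ℝ[X] := σ₃ * R₁ ^ 3 - σ₂ * R₀ * R₁ ^ 2 + σ₁ * R₀ ^ 2 * R₁ - R₀ ^ 3 with hN'def
  -- shorthand consequences of membership
  have hpos0 : ∀ p ∈ osc, 0 < p 0 := fun p hp => (hout p hp).1
  have hpos1 : ∀ p ∈ osc, 0 < p 1 := fun p hp => (hout p hp).2.1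
  have hcub : ∀ p ∈ osc, p 1 ^ 3 + p 1 ^ 2 * σ₁.eval (p 0) + p 1 * σ₂.eval (p 0) + σ₃.eval (p 0) = 0 :=
    fun p hp => (hout p hp).2.2.1
  have hR : ∀ p ∈ osc, R₂.eval (p 0) * p 1 ^ 2 + R₁.eval (p 0) * p 1 + R₀.eval (p 0) = 0 :=
    fun p hp => (hout p hp).2.2.2
  -- the two Euclid identities, evaluated
  have hEuclid : ∀ t b : ℝ, R₂.eval t ^ 2 * (b ^ 3 + b ^ 2 * σ₁.eval t + b * σ₂.eval t + σ₃.eval t) =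
      (R₂.eval t * b + (σ₁.eval t * R₂.eval t - R₁.eval t)) * (R₂.eval t * b ^ 2 + R₁.eval t * b + R₀.eval t)
        + (L₁.eval t * b + L₀.eval t) := by
    intro t b
    rw [hL₁def, hL₀def]
    simp only [eval_add, eval_sub, eval_mul, eval_pow]
    ring
  have hNq : ∀ t b : ℝ, L₁.eval t * b + L₀.eval t = 0 →
      N.eval t = L₁.eval t ^ 2 * (R₂.eval t * b ^ 2 + R₁.eval t * b + R₀.eval t) := by
    intro t b h
    have h0 : L₀.eval t = -(L₁.eval t * b) := by linarith
    rw [hNdef]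
    simp only [eval_add, eval_sub, eval_mul, eval_pow]
    rw [h0]
    ring
  have hN'q : ∀ t b : ℝ, R₁.eval t * b + R₀.eval t = 0 →
      N'.eval t = R₁.eval t ^ 3 * (b ^ 3 + b ^ 2 * σ₁.eval t + b * σ₂.eval t + σ₃.eval t) := by
    intro t b h
    have h0 : R₀.eval t = -(R₁.eval t * b) := by linarith
    rw [hN'def]
    simp only [eval_add, eval_sub, eval_mul, eval_pow]
    rw [h0]
    ring
  have hL : ∀ p ∈ osc, L₁.eval (p 0) * p 1 + L₀.eval (p 0) = 0 := by
    intro p hp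
    have h := hEuclid (p 0) (p 1)
    rw [hcub p hp, hR p hp, mul_zero, mul_zero, zero_add] at h
    exact h.symm
  have hNroot : ∀ p ∈ osc, N.IsRoot (p 0) := by
    intro p hp
    rw [IsRoot.def, hNq (p 0) (p 1) (hL p hp), hR p hp, mul_zero]
  -- the empty case
  rcases Set.eq_empty_or_nonempty osc with hempty | hne
  · rw [hempty, Set.ncard_empty]; exact Nat.zero_le _
  by_cases hR2 : R₂ = 0
  · /- LINEAR REGIME `R = R₁ b + R₀` -/
    have hRlin : ∀ p ∈ osc, R₁.eval (p 0) * p 1 + R₀.eval (p 0) = 0 := by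
      intro p hp
      have h := hR p hp
      rw [hR2, eval_zero, zero_mul, zero_add] at h
      exact h
    have hN'root : ∀ p ∈ osc, N'.IsRoot (p 0) := by
      intro p hp
      rw [IsRoot.def, hN'q (p 0) (p 1) (hRlin p hp), hcub p hp, mul_zero]
    by_cases hR1 : R₁ = 0
    · by_cases hR0 : R₀ = 0
      · -- `R ≡ 0`: every positive point of the curve osculates; persistence gives an open arc
        exfalso
        obtain ⟨p₀, hp₀⟩ := hne
        obtain ⟨U, hU, ht₀U, γ, hγ⟩ := hpersist (p₀ 0) (p₀ 1) (hpos1 p₀ hp₀) (hcub p₀ hp₀)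
        apply hfin.not_infinite
        refine OsculationCusp.infinite_of_curve (U := U ∩ Set.Ioi 0) (hU.inter isOpen_Ioi) (t₀ := p₀ 0)
          ⟨ht₀U, hpos0 p₀ hp₀⟩ γ ?_
        intro t ht
        obtain ⟨hγpos, hγroot⟩ := hγ t ht.1
        refine hin t (γ t) ht.2 hγpos hγroot ?_
        rw [hR2, hR1, hR0, eval_zero]
        ring
      · -- `R = R₀(t) ≢ 0`: every abscissa is a root of `R₀`
        have h := fibre_three_le σ₁ σ₂ σ₃ R₀ hR0 osc (fun p hp => ⟨hpos0 p hp, ?_, hcub p hp⟩)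
        · nlinarith [h, Nat.zero_le N.support.card, Nat.zero_le N'.support.card, Nat.zero_le R₂.support.card,
            Nat.zero_le R₁.support.card, Nat.zero_le L₁.support.card, Nat.zero_le L₀.support.card]
        · have h1 := hRlin p hp
          rw [hR1, eval_zero, zero_mul, zero_add] at h1
          exact h1
    · -- `R₁ ≢ 0`
      set T0 : Set (Fin 2 → ℝ) := {p | p ∈ osc ∧ R₁.eval (p 0) = 0} with hT0
      set T1 : Set (Fin 2 → ℝ) := {p | p ∈ osc ∧ R₁.eval (p 0) ≠ 0} with hT1
      have hsplit : osc = T0 ∪ T1 := by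
        ext p
        simp only [hT0, hT1, Set.mem_union, Set.mem_setOf_eq]
        tauto
      have hT0c : T0.ncard ≤ 3 * R₁.support.card :=
        fibre_three_le σ₁ σ₂ σ₃ R₁ hR1 T0 (fun p hp => ⟨hpos0 p hp.1, hp.2, hcub p hp.1⟩)
      have hT1c : T1.ncard ≤ N'.support.card := by
        by_cases hN'z : N' = 0
        · -- `N′ ≡ 0`: the would-be points `(t, −R₀/R₁)` over `{R₀R₁ < 0}` form an open arc
          have hT1e : T1 = ∅ := by
            rcases Set.eq_empty_or_nonempty T1 with h | ⟨p, hp⟩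
            · exact h
            exfalso
            have hR1p : R₁.eval (p 0) ≠ 0 := hp.2
            have hlin := hRlin p hp.1
            have hb := hpos1 p hp.1
            apply hfin.not_infinite
            have hc : Continuous fun t => R₀.eval t * R₁.eval t := R₀.continuous.mul R₁.continuous
            refine OsculationCusp.infinite_of_curve (U := {t | 0 < t ∧ R₀.eval t * R₁.eval t < 0})
              ((isOpen_lt continuous_const continuous_id).inter (isOpen_lt hc continuous_const))
              (t₀ := p 0) ⟨hpos0 p hp.1, ?_⟩ (fun t => -(R₀.eval t) / R₁.eval t) ?_
            · have h0 : R₀.eval (p 0) = -(R₁.eval (p 0) * p 1) := by linarith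
              rw [h0]
              nlinarith [mul_self_pos.2 hR1p]
            · intro t ht
              obtain ⟨htpos, hprod⟩ := ht
              have hR1t : R₁.eval t ≠ 0 := by
                intro h0; rw [h0, mul_zero] at hprod; exact lt_irrefl _ hprod
              have hq : R₁.eval t * (-(R₀.eval t) / R₁.eval t) + R₀.eval t = 0 := by
                field_simp; ring
              have hcubt : (-(R₀.eval t) / R₁.eval t) ^ 3 + (-(R₀.eval t) / R₁.eval t) ^ 2 * σ₁.eval t
                  + (-(R₀.eval t) / R₁.eval t) * σ₂.eval t + σ₃.eval t = 0 := by
                have hN't : N'.eval t = 0 := by rw [hN'z, eval_zero]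
                rw [hN'q t _ hq] at hN't
                rcases mul_eq_zero.1 hN't with h | h
                · exact absurd ((pow_eq_zero_iff (by norm_num)).1 h) hR1t
                · exact h
              have hbpos : 0 < -(R₀.eval t) / R₁.eval t := by
                have h1 : -(R₀.eval t) / R₁.eval t = (-(R₀.eval t * R₁.eval t)) / (R₁.eval t * R₁.eval t) := by
                  field_simp
                rw [h1]
                exact div_pos (by linarith) (mul_self_pos.2 hR1t)
              refine hin t _ htpos hbpos hcubt ?_
              rw [hR2, eval_zero, zero_mul, zero_add]
              exact hq
          rw [hT1e, Set.ncard_empty]; exact Nat.zero_le _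
        · refine inj_le N' hN'z T1 (fun p hp => ⟨hpos0 p hp.1, hN'root p hp.1⟩) ?_
          intro p hp q hq hpq
          have h1 := hRlin p hp.1
          have h2 := hRlin q hq.1
          rw [← hpq] at h2
          have h3 : R₁.eval (p 0) * (p 1 - q 1) = 0 := by linarith
          rcases mul_eq_zero.1 h3 with h | h
          · exact absurd h hp.2
          · linarith
      calc osc.ncard = (T0 ∪ T1).ncard := by rw [← hsplit]
        _ ≤ T0.ncard + T1.ncard := Set.ncard_union_le _ _
        _ ≤ 3 * R₁.support.card + N'.support.card := Nat.add_le_add hT0c hT1c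
        _ ≤ _ := by
            nlinarith [Nat.zero_le N.support.card, Nat.zero_le R₂.support.card, Nat.zero_le R₀.support.card,
              Nat.zero_le L₁.support.card, Nat.zero_le L₀.support.card]
  · /- QUADRATIC REGIME `R₂ ≢ 0` -/
    set S0 : Set (Fin 2 → ℝ) := {p | p ∈ osc ∧ R₂.eval (p 0) = 0} with hS0
    set S1 : Set (Fin 2 → ℝ) := {p | p ∈ osc ∧ R₂.eval (p 0) ≠ 0 ∧ L₁.eval (p 0) ≠ 0} with hS1
    set S2 : Set (Fin 2 → ℝ) := {p | p ∈ osc ∧ R₂.eval (p 0) ≠ 0 ∧ L₁.eval (p 0) = 0} with hS2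
    have hsplit : osc = S0 ∪ S1 ∪ S2 := by
      ext p
      simp only [hS0, hS1, hS2, Set.mem_union, Set.mem_setOf_eq]
      tauto
    have hS0c : S0.ncard ≤ 3 * R₂.support.card :=
      fibre_three_le σ₁ σ₂ σ₃ R₂ hR2 S0 (fun p hp => ⟨hpos0 p hp.1, hp.2, hcub p hp.1⟩)
    -- generic stratum: one ordinate `b = −L₀/L₁`, abscissae in `Z₊(N)`
    have hS1c : S1.ncard ≤ N.support.card := by
      by_cases hNz : N = 0
      · have hS1e : S1 = ∅ := by
          rcases Set.eq_empty_or_nonempty S1 with h | ⟨p, hp⟩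
          · exact h
          exfalso
          have hR2p : R₂.eval (p 0) ≠ 0 := hp.2.1
          have hL1p : L₁.eval (p 0) ≠ 0 := hp.2.2
          have hlin := hL p hp.1
          have hb := hpos1 p hp.1
          apply hfin.not_infinite
          have hc : Continuous fun t => L₀.eval t * L₁.eval t := L₀.continuous.mul L₁.continuous
          have hV : IsOpen {t : ℝ | R₂.eval t ≠ 0} := isOpen_ne_fun R₂.continuous continuous_const
          refine OsculationCusp.infinite_of_curve
            (U := {t | 0 < t ∧ L₀.eval t * L₁.eval t < 0} ∩ {t : ℝ | R₂.eval t ≠ 0})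
            (((isOpen_lt continuous_const continuous_id).inter (isOpen_lt hc continuous_const)).inter hV)
            (t₀ := p 0) ⟨⟨hpos0 p hp.1, ?_⟩, hR2p⟩ (fun t => -(L₀.eval t) / L₁.eval t) ?_
          · have h0 : L₀.eval (p 0) = -(L₁.eval (p 0) * p 1) := by linarith
            rw [h0]
            nlinarith [mul_self_pos.2 hL1p]
          · intro t ht
            obtain ⟨⟨htpos, hprod⟩, hR2t⟩ := ht
            have hL1t : L₁.eval t ≠ 0 := by
              intro h0; rw [h0, mul_zero] at hprod; exact lt_irrefl _ hprod
            have hl : L₁.eval t * (-(L₀.eval t) / L₁.eval t) + L₀.eval t = 0 := by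
              field_simp; ring
            have hq : R₂.eval t * (-(L₀.eval t) / L₁.eval t) ^ 2 + R₁.eval t * (-(L₀.eval t) / L₁.eval t)
                + R₀.eval t = 0 := by
              have hNt : N.eval t = 0 := by rw [hNz, eval_zero]
              rw [hNq t _ hl] at hNt
              rcases mul_eq_zero.1 hNt with h | h
              · exact absurd ((pow_eq_zero_iff (by norm_num)).1 h) hL1t
              · exact h
            have hcubt : (-(L₀.eval t) / L₁.eval t) ^ 3 + (-(L₀.eval t) / L₁.eval t) ^ 2 * σ₁.eval t
                + (-(L₀.eval t) / L₁.eval t) * σ₂.eval t + σ₃.eval t = 0 := by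
              have h := hEuclid t (-(L₀.eval t) / L₁.eval t)
              rw [hq, hl, mul_zero, zero_add] at h
              rcases mul_eq_zero.1 h with h' | h'
              · exact absurd ((pow_eq_zero_iff (by norm_num)).1 h') hR2t
              · exact h'
            have hbpos : 0 < -(L₀.eval t) / L₁.eval t := by
              have h1 : -(L₀.eval t) / L₁.eval t = (-(L₀.eval t * L₁.eval t)) / (L₁.eval t * L₁.eval t) := by
                field_simp
              rw [h1]
              exact div_pos (by linarith) (mul_self_pos.2 hL1t)
            exact hin t _ htpos hbpos hcubt hq
        rw [hS1e, Set.ncard_empty]; exact Nat.zero_le _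
      · refine inj_le N hNz S1 (fun p hp => ⟨hpos0 p hp.1, hNroot p hp.1⟩) ?_
        intro p hp q hq hpq
        have h1 := hL p hp.1
        have h2 := hL q hq.1
        rw [← hpq] at h2
        have h3 : L₁.eval (p 0) * (p 1 - q 1) = 0 := by linarith
        rcases mul_eq_zero.1 h3 with h | h
        · exact absurd h hp.2.2
        · linarith
    -- the stratum `L₁(t) = 0`
    have hS2c : S2.ncard ≤ 3 * (L₁.support.card + L₀.support.card) := by
      by_cases hL1z : L₁ = 0
      · have hL0v : ∀ p ∈ osc, L₀.eval (p 0) = 0 := by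
          intro p hp
          have h := hL p hp
          rw [hL1z, eval_zero, zero_mul, zero_add] at h
          exact h
        by_cases hL0z : L₀ = 0
        · -- `L ≡ 0`: `R(t,·)` divides `R₂² Φ(t,·)`, so a root branch of `R` is an open arc of osculation points
          have hS2e : S2 = ∅ := by
            rcases Set.eq_empty_or_nonempty S2 with h | ⟨p, hp⟩
            · exact h
            exfalso
            have hR2p : R₂.eval (p 0) ≠ 0 := hp.2.1
            have hb := hpos1 p hp.1
            -- the factorisation `R₂² Φ = (R₂ b + c)·R`
            have hid : ∀ t b : ℝ, R₂.eval t ^ 2 * (b ^ 3 + b ^ 2 * σ₁.eval t + b * σ₂.eval t + σ₃.eval t) =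
                (R₂.eval t * b + (σ₁.eval t * R₂.eval t - R₁.eval t))
                  * (R₂.eval t * b ^ 2 + R₁.eval t * b + R₀.eval t) := by
              intro t b
              have h := hEuclid t b
              rw [hL1z, hL0z, eval_zero, zero_mul, add_zero, add_zero] at h
              exact h
            have hD : ∀ t : ℝ, R₂.eval t ≠ 0 → 0 ≤ R₁.eval t ^ 2 - 4 * R₂.eval t * R₀.eval t :=
              fun t ht => disc_nonneg_of_factor ht (hreal t) (hid t)
            -- the branch through `p`
            obtain ⟨ε, hε, hpε⟩ : ∃ ε : ℝ, (ε = 1 ∨ ε = -1) ∧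
                p 1 = (-R₁.eval (p 0) + ε * Real.sqrt (R₁.eval (p 0) ^ 2 - 4 * R₂.eval (p 0) * R₀.eval (p 0)))
                  / (2 * R₂.eval (p 0)) := by
              rcases root_formula hR2p (hD _ hR2p) (hR p hp.1) with h | h
              · exact ⟨1, Or.inl rfl, by rw [one_mul]; exact h⟩
              · exact ⟨-1, Or.inr rfl, by rw [neg_one_mul, ← sub_eq_add_neg]; exact h⟩
            set ρ : ℝ → ℝ := fun t =>
              (-R₁.eval t + ε * Real.sqrt (R₁.eval t ^ 2 - 4 * R₂.eval t * R₀.eval t)) / (2 * R₂.eval t) with hρ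
            have hV : IsOpen {t : ℝ | R₂.eval t ≠ 0} := isOpen_ne_fun R₂.continuous continuous_const
            have hρc : ContinuousOn ρ {t : ℝ | R₂.eval t ≠ 0} := by
              have hnum : Continuous fun t => -R₁.eval t
                  + ε * Real.sqrt (R₁.eval t ^ 2 - 4 * R₂.eval t * R₀.eval t) :=
                R₁.continuous.neg.add (continuous_const.mul
                  (((R₁.continuous.pow 2).sub ((continuous_const.mul R₂.continuous).mul R₀.continuous)).sqrt))
              have hden : Continuous fun t => 2 * R₂.eval t := continuous_const.mul R₂.continuous
              exact hnum.continuousOn.div hden.continuousOn (fun t ht => mul_ne_zero two_ne_zero ht)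
            apply hfin.not_infinite
            refine OsculationCusp.infinite_of_curve
              (U := Set.Ioi 0 ∩ ({t : ℝ | R₂.eval t ≠ 0} ∩ ρ ⁻¹' Set.Ioi 0))
              (isOpen_Ioi.inter (hρc.isOpen_inter_preimage hV isOpen_Ioi))
              (t₀ := p 0) ⟨hpos0 p hp.1, hR2p, ?_⟩ ρ ?_
            · show 0 < ρ (p 0)
              rw [hρ]; dsimp only; rw [← hpε]; exact hb
            · intro t ht
              obtain ⟨htpos, hR2t, hρpos⟩ := ht
              have hq : R₂.eval t * ρ t ^ 2 + R₁.eval t * ρ t + R₀.eval t = 0 := by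
                rw [hρ]; exact root_of_formula hR2t (hD t hR2t) hε
              have hcubt : ρ t ^ 3 + ρ t ^ 2 * σ₁.eval t + ρ t * σ₂.eval t + σ₃.eval t = 0 := by
                have h := hid t (ρ t)
                rw [hq, mul_zero] at h
                rcases mul_eq_zero.1 h with h' | h'
                · exact absurd ((pow_eq_zero_iff (by norm_num)).1 h') hR2t
                · exact h'
              exact hin t (ρ t) htpos hρpos hcubt hq
          rw [hS2e, Set.ncard_empty]; exact Nat.zero_le _
        · have h := fibre_three_le σ₁ σ₂ σ₃ L₀ hL0z S2 (fun p hp => ⟨hpos0 p hp.1, hL0v p hp.1, hcub p hp.1⟩)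
          nlinarith [h, Nat.zero_le L₁.support.card]
      · have h := fibre_three_le σ₁ σ₂ σ₃ L₁ hL1z S2 (fun p hp => ⟨hpos0 p hp.1, hp.2.2, hcub p hp.1⟩)
        nlinarith [h, Nat.zero_le L₀.support.card]
    calc osc.ncard = (S0 ∪ S1 ∪ S2).ncard := by rw [← hsplit]
      _ ≤ (S0 ∪ S1).ncard + S2.ncard := Set.ncard_union_le _ _
      _ ≤ S0.ncard + S1.ncard + S2.ncard := Nat.add_le_add_right (Set.ncard_union_le _ _) _
      _ ≤ 3 * R₂.support.card + N.support.card + 3 * (L₁.support.card + L₀.support.card) :=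
          Nat.add_le_add (Nat.add_le_add hS0c hS1c) hS2c
      _ ≤ _ := by
          nlinarith [Nat.zero_le N'.support.card, Nat.zero_le R₁.support.card, Nat.zero_le R₀.support.card]

end OsculationCuspCubic

end Summit.ValiantsHypothesis.ValiantsHypothesis.Theorems.LacunarySymmetroidMatrixDescartes
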